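import Literature.NumberTheory.Sieve.RoughOmegaCellsClassesBVBoxes
import Literature.NumberTheory.Sieve.RoughOmegaCellsClassesBVPrimes
import Literature.NumberTheory.Sieve.BombieriFriedlanderIwaniecBilinearProofs
import HarnessLib

/-!
# Bombieri–Vinogradov for the `Ω`-cells of the rough integers, V: Theorem 0 (b) on one box

Topic `Literature/NumberTheory/Sieve`, sub-namespace `RoughCellsAP`.  Everything here is PROVED.
The bilinear Bombieri–Vinogradov theorem of Bombieri–Friedlander–Iwaniec (Acta Math. 156 (1986),
Theorem 0 (b), p. 211 = Motohashi 1976; PROVED in the tree as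
`BombieriFriedlanderIwaniecTheorem0b_holds`) applied to ONE product box of the covering of
`RoughOmegaCellsClassesBVBoxes.lean`: `α = 1_{A_{k,i}}` (the cell `Ω = j` of the `⌈Y⌉`-rough
integers in the dyadic range `M = (1+δ)^k 2^{-i-1}`), `β = 1_{B_k}` (the primes `p ≥ Y` of the box
`(X(1+δ)^{-k-1}, X(1+δ)^{-k}]`, a prime piece at scale `N = X(1+δ)^{-k-1}`, hypothesis (A₂) by
`siegelWalfiszHyp_primePiece`), `x = MN = X/((1+δ)2^{i+1}) ∈ [X^{3/4}/2, X]`: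

* `sum_abs_pairDisc_box_le` — for `n ≥ 1`, `A' > 0` there are `B₁ > 0`, `C ≥ 0`, `x₀` with
  `Σ_{q ≤ X^{1/4}} |D_q(A_{k,i} × B_k)| ≤ C X (log X / 2)^{-A'}` for all boxes with
  `2^{i+1} ≤ X^{1/4}`, all `2 ≤ Y ≤ X` with `X^{1/n} ≤ Y`, `0 < δ ≤ 1`, `j ≥ 1`, once
  `X^{3/4}/2 ≥ x₀, 4^n`, `X ≥ 16, 4^n` and `X^{1/4} (log X)^{B₁} ≤ (X^{3/4}/2)^{1/2}`.

## References

* Y. Motohashi, Proc. Japan Acad. 52 (1976), 273–275.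
* E. Bombieri, J. B. Friedlander, H. Iwaniec, Acta Math. 156 (1986), 203–251, §2 Theorem 0 (b)
  p. 211. [BombieriFriedlanderIwaniecActa1986]
-/

open Finset
open scoped ArithmeticFunction.Omega

namespace Literature.NumberTheory.Sieve

namespace RoughCellsAP

open BFI

/-! Local notation (as in the companion files). -/
local notation3 (prettyPrint := false) "cellΩ" N₀:max T:max i:max =>
  Finset.filter (fun b : ℕ => ArithmeticFunction.cardFactors b = i) (roughIcc N₀ T)
local notation3 (prettyPrint := false) "primesIn" N₀:max T:max =>
  Finset.filter (fun p : ℕ => Nat.Prime p ∧ N₀ ≤ p) (Finset.Icc 1 T)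
local notation3 (prettyPrint := false) "boxA" N₀:max T:max j:max δ:max k:max i:max =>
  Finset.filter (fun m : ℕ => BFI.InBox ((1 + δ) ^ k) 1 i m) (cellΩ N₀ T j)
local notation3 (prettyPrint := false) "boxB" N₀:max T:max X:max δ:max k:max =>
  Finset.filter (fun p : ℕ => BFI.InBox X δ k p) (primesIn N₀ T)

/-! ### Scale bookkeeping -/

/-- `(2^{2n})^{1/(2n)} = 2`. [folklore] -/
theorem rpow_two_pow_two_mul (n : ℕ) (hn : 0 < n) : ((2 : ℝ) ^ (2 * n)) ^ (1 / (2 * (n : ℝ))) = 2 := by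
  have hn0 : (0 : ℝ) < n := by exact_mod_cast hn
  rw [← Real.rpow_natCast, ← Real.rpow_mul (by norm_num)]
  push_cast
  rw [show (2 * (n : ℝ)) * (1 / (2 * (n : ℝ))) = 1 by field_simp, Real.rpow_one]

/-- The ranges of Theorem 0 (b): if `x ≥ 4^n`, `x ≤ X`, `X^{1/n} ≤ Y`, `Y ≤ 2M`, `Y ≤ 2N` and
`MN = x`, then `x^{1/(2n)} ≤ N ≤ x^{1 − 1/(2n)}`. [folklore] -/
theorem scale_range {n : ℕ} (hn : 0 < n) {x X Y M N : ℝ} (hx4 : (2 : ℝ) ^ (2 * n) ≤ x) (hxX : x ≤ X)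
    (hXY : X ^ (1 / (n : ℝ)) ≤ Y) (hYM : Y ≤ 2 * M) (hYN : Y ≤ 2 * N) (hM : 0 < M) (hMN : M * N = x) :
    x ^ (1 / (2 * (n : ℝ))) ≤ N ∧ N ≤ x ^ (1 - 1 / (2 * (n : ℝ))) := by
  have hn0 : (0 : ℝ) < n := by exact_mod_cast hn
  have hx0 : 0 < x := lt_of_lt_of_le (by positivity) hx4
  set t : ℝ := x ^ (1 / (2 * (n : ℝ))) with ht
  have ht2 : 2 ≤ t := by
    have h := Real.rpow_le_rpow (by positivity) hx4 (by positivity : (0 : ℝ) ≤ 1 / (2 * (n : ℝ)))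
    rwa [rpow_two_pow_two_mul n hn] at h
  have ht0 : 0 < t := by linarith
  have htsq : t * t = x ^ (1 / (n : ℝ)) := by
    rw [ht, ← Real.rpow_add hx0]; congr 1; field_simp; ring
  -- `x^{1/n} ≤ X^{1/n} ≤ Y`
  have hxY : x ^ (1 / (n : ℝ)) ≤ Y := le_trans (Real.rpow_le_rpow hx0.le hxX (by positivity)) hXY
  constructor
  · -- `t ≤ t²/2 ≤ Y/2 ≤ N`
    nlinarith
  · -- `N = x/M ≤ 2x/Y ≤ 2x/x^{1/n} = 2 x^{1-1/n} ≤ t x^{1-1/n} = x^{1-1/(2n)}`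
    have hN : N = x / M := by rw [← hMN]; field_simp
    have hY0 : 0 < Y := by nlinarith
    have h1 : N ≤ 2 * x / Y := by
      rw [hN, div_le_div_iff₀ hM hY0]; nlinarith
    have h2 : 2 * x / Y ≤ 2 * x / (t * t) := by
      rw [htsq]; exact div_le_div_of_nonneg_left (by positivity) (by positivity) hxY
    have h3 : 2 * x / (t * t) ≤ t * x / (t * t) :=
      div_le_div_of_nonneg_right (mul_le_mul_of_nonneg_right ht2 hx0.le) (by positivity)
    have h4 : t * x / (t * t) = x ^ (1 - 1 / (2 * (n : ℝ))) := by
      rw [mul_div_mul_left _ _ ht0.ne', ht, Real.rpow_sub hx0, Real.rpow_one]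
    linarith

/-- The level: `X^{1/4} ≤ x^{1/2} (log x)^{-B₁}` once `X^{3/4}/2 ≤ x ≤ X`, `x ≥ 4` and
`X^{1/4} (log X)^{B₁} ≤ (X^{3/4}/2)^{1/2}`. [folklore] -/
theorem level_le {X x B₁ : ℝ} (hB₁ : 0 < B₁) (hx4 : 4 ≤ x) (hxlo : X ^ (3 / 4 : ℝ) / 2 ≤ x) (hxX : x ≤ X)
    (hlev : X ^ (1 / 4 : ℝ) * Real.log X ^ B₁ ≤ (X ^ (3 / 4 : ℝ) / 2) ^ (1 / 2 : ℝ)) :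
    X ^ (1 / 4 : ℝ) ≤ x ^ (1 / 2 : ℝ) / Real.log x ^ B₁ := by
  have hx0 : 0 < x := by linarith
  have hX0 : 0 ≤ X := by linarith
  have hlogx : 0 < Real.log x := Real.log_pos (by linarith)
  have hlogX : Real.log x ≤ Real.log X := Real.log_le_log hx0 hxX
  have hLx : 0 < Real.log x ^ B₁ := Real.rpow_pos_of_pos hlogx _
  rw [le_div_iff₀ hLx]
  calc X ^ (1 / 4 : ℝ) * Real.log x ^ B₁ ≤ X ^ (1 / 4 : ℝ) * Real.log X ^ B₁ :=
        mul_le_mul_of_nonneg_left (Real.rpow_le_rpow hlogx.le hlogX hB₁.le) (Real.rpow_nonneg hX0 _)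
    _ ≤ (X ^ (3 / 4 : ℝ) / 2) ^ (1 / 2 : ℝ) := hlev
    _ ≤ x ^ (1 / 2 : ℝ) := Real.rpow_le_rpow (by positivity) hxlo (by norm_num)

/-- The scale of a box: `MN = X/((1+δ) 2^{i+1})` lies in `[X^{3/4}/2, X]` when `2^{i+1} ≤ X^{1/4}`,
`0 ≤ δ ≤ 1`, `X ≥ 1`. [folklore] -/
theorem box_scale {X δ : ℝ} (hX : 1 ≤ X) (hδ : 0 ≤ δ) (hδ1 : δ ≤ 1) (k i : ℕ)
    (hi : (2 : ℝ) ^ (i + 1) ≤ X ^ (1 / 4 : ℝ)) :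
    (1 + δ) ^ k / 2 ^ (i + 1) * (X / (1 + δ) ^ (k + 1)) = X / ((1 + δ) * 2 ^ (i + 1)) ∧
      X ^ (3 / 4 : ℝ) / 2 ≤ X / ((1 + δ) * 2 ^ (i + 1)) ∧ X / ((1 + δ) * 2 ^ (i + 1)) ≤ X := by
  have hX0 : 0 < X := by linarith
  have hpow : 0 < (1 + δ) ^ k := by positivity
  refine ⟨?_, ?_, ?_⟩
  · field_simp
    ring
  · have h34 : X ^ (3 / 4 : ℝ) = X / X ^ (1 / 4 : ℝ) := by
      rw [eq_div_iff (Real.rpow_pos_of_pos hX0 _).ne', ← Real.rpow_add hX0]; norm_num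
    rw [h34, div_div]
    refine div_le_div_of_nonneg_left hX0.le (by positivity) ?_
    calc (1 + δ) * 2 ^ (i + 1) ≤ 2 * X ^ (1 / 4 : ℝ) := mul_le_mul (by linarith) hi (by positivity) (by norm_num)
      _ = X ^ (1 / 4 : ℝ) * 2 := mul_comm _ _
  · refine div_le_self hX0.le ?_
    calc (1 : ℝ) = 1 * 1 := (mul_one 1).symm
      _ ≤ (1 + δ) * 2 ^ (i + 1) := mul_le_mul (by linarith) (one_le_pow₀ (by norm_num)) zero_le_one (by linarith)

/-- Norms of indicators: `√(2M+1) √(2N+1) x^{1/2} ≤ 4x` for `M, N ≥ 1/2`, `MN = x`. [folklore] -/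
theorem sqrt_mul_sqrt_mul_rpow_le {M N x : ℝ} (hM : 1 / 2 ≤ M) (hN : 1 / 2 ≤ N) (hMN : M * N = x) :
    Real.sqrt (2 * M + 1) * Real.sqrt (2 * N + 1) * x ^ (1 / 2 : ℝ) ≤ 4 * x := by
  have hx0 : 0 ≤ x := by rw [← hMN]; positivity
  have h1 : Real.sqrt (2 * M + 1) * Real.sqrt (2 * N + 1) ≤ 4 * Real.sqrt x := by
    rw [← Real.sqrt_mul (by linarith), show (4 : ℝ) = Real.sqrt 16 by
      rw [show (16 : ℝ) = 4 ^ 2 by norm_num, Real.sqrt_sq (by norm_num)], ← Real.sqrt_mul (by norm_num)]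
    refine Real.sqrt_le_sqrt ?_
    rw [← hMN]; nlinarith
  rw [← Real.sqrt_eq_rpow]
  calc Real.sqrt (2 * M + 1) * Real.sqrt (2 * N + 1) * Real.sqrt x ≤ 4 * Real.sqrt x * Real.sqrt x :=
        mul_le_mul_of_nonneg_right h1 (Real.sqrt_nonneg _)
    _ = 4 * x := by rw [mul_assoc, Real.mul_self_sqrt hx0]

/-! ### Theorem 0 (b) on one box -/

set_option maxHeartbeats 400000 in
/-- **Theorem 0 (b) on one box.**  For `n ≥ 1` and `A' > 0` there are `B₁ > 0`, `C ≥ 0`, `x₀`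
such that for all `X, Y, δ` with `x₀ ≤ X^{3/4}/2`, `4^n ≤ X^{3/4}/2`, `4^n ≤ X`, `16 ≤ X`,
`X^{1/4}(log X)^{B₁} ≤ (X^{3/4}/2)^{1/2}`, `2 ≤ Y ≤ X`, `X^{1/n} ≤ Y`, `0 < δ ≤ 1`, all `j ≥ 1`, all
boxes `(k, i)` with `2^{i+1} ≤ X^{1/4}` and all reduced residues `c_q`:
`Σ_{q ≤ X^{1/4}} |#{(m,p) ∈ A_{k,i} × B_k : mp ≡ c_q (q)} − #{(m,p) : (mp, q) = 1}/φ(q)| ≤ C X (log X/2)^{-A'}`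
(BFI Theorem 0 (b) with `ε = 1/(2n)`, the prime box carrying (A₂) by `siegelWalfiszHyp_primePiece`).
[cite: BombieriFriedlanderIwaniecActa1986, §2 Theorem 0 (b) p. 211] -/
theorem sum_abs_pairDisc_box_le {n : ℕ} (hn : 0 < n) {A' : ℝ} (hA' : 0 < A') :
    ∃ B₁ C x₀ : ℝ, 0 < B₁ ∧ 0 ≤ C ∧ ∀ X Y δ : ℝ, x₀ ≤ X ^ (3 / 4 : ℝ) / 2 →
      (2 : ℝ) ^ (2 * n) ≤ X ^ (3 / 4 : ℝ) / 2 → (2 : ℝ) ^ (2 * n) ≤ X → 16 ≤ X →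
      X ^ (1 / 4 : ℝ) * Real.log X ^ B₁ ≤ (X ^ (3 / 4 : ℝ) / 2) ^ (1 / 2 : ℝ) →
      2 ≤ Y → Y ≤ X → X ^ (1 / (n : ℝ)) ≤ Y → 0 < δ → δ ≤ 1 →
      ∀ j k i : ℕ, 1 ≤ j → (2 : ℝ) ^ (i + 1) ≤ X ^ (1 / 4 : ℝ) →
      ∀ c : ℕ → ℕ, (∀ q : ℕ, 0 < q → (c q).Coprime q) →
        ∑ q ∈ Finset.Icc 1 ⌊X ^ ((1 : ℝ) / 4)⌋₊,
          |(#(((boxA ⌈Y⌉₊ ⌊X⌋₊ j δ k i) ×ˢ (boxB ⌈Y⌉₊ ⌊X⌋₊ X δ k)).filter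
                (fun x : ℕ × ℕ => x.1 * x.2 ≡ c q [MOD q])) : ℝ) -
            (#(((boxA ⌈Y⌉₊ ⌊X⌋₊ j δ k i) ×ˢ (boxB ⌈Y⌉₊ ⌊X⌋₊ X δ k)).filter
                (fun x : ℕ × ℕ => (x.1 * x.2).Coprime q)) : ℝ) / (Nat.totient q : ℝ)| ≤
          C * X / (Real.log X / 2) ^ A' := by
  have hn0 : (0 : ℝ) < n := by exact_mod_cast hn
  obtain ⟨Csw, hCsw⟩ := siegelWalfiszHyp_primePiece hn
  obtain ⟨B₁, C₀, x₀, hB₁, hC₀, hBFI⟩ := BombieriFriedlanderIwaniecTheorem0b_holds.nonneg_const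
    (ε := 1 / (2 * (n : ℝ))) (by positivity) hA' (B := 1) zero_le_one Csw
  refine ⟨B₁, 4 * C₀, x₀, hB₁, by positivity, ?_⟩
  intro X Y δ hx₀ h4n h4nX h16 hlev hY hYX hXY hδ hδ1 j k i hj hi c hc
  have hX1 : 1 ≤ X := by linarith
  have hX0 : 0 < X := by linarith
  have hlogX : 0 < Real.log X := Real.log_pos (by linarith)
  have hRHS : 0 ≤ 4 * C₀ * X / (Real.log X / 2) ^ A' := by positivity
  set N₀ : ℕ := ⌈Y⌉₊ with hN₀
  set T : ℕ := ⌊X⌋₊ with hT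
  set M : ℝ := (1 + δ) ^ k / 2 ^ (i + 1) with hM
  set N : ℝ := X / (1 + δ) ^ (k + 1) with hN
  have hM0 : 0 < M := by positivity
  have hN0' : 0 < N := by positivity
  obtain ⟨hMN, hxlo, hxX⟩ := box_scale hX1 hδ.le hδ1 k i hi
  rw [← hM, ← hN] at hMN
  set x : ℝ := X / ((1 + δ) * 2 ^ (i + 1)) with hxdef
  -- empty boxes contribute nothing
  by_cases hne : (boxA N₀ T j δ k i).Nonempty ∧ (boxB N₀ T X δ k).Nonempty
  swap
  · rw [not_and_or, Finset.not_nonempty_iff_eq_empty, Finset.not_nonempty_iff_eq_empty,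
      ← Finset.product_eq_empty] at hne
    rw [hne]
    simp only [Finset.filter_empty, Finset.card_empty, Nat.cast_zero, zero_div, sub_zero, abs_zero,
      Finset.sum_const_zero]
    exact hRHS
  obtain ⟨⟨m₀, hm₀⟩, ⟨p₀, hp₀⟩⟩ := hne
  -- `Y ≤ 2M`, `Y ≤ 2N`
  have hN₀Y : Y ≤ N₀ := Nat.le_ceil Y
  have hN₀1 : 1 ≤ N₀ := by
    have : (1 : ℝ) ≤ N₀ := by linarith
    exact_mod_cast this
  have hYM : Y ≤ 2 * M := by
    have hmd := (mem_dyadic hM0.le).1 (boxA_subset_dyadic hδ.le k i hm₀)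
    have hmcell := (Finset.mem_filter.1 hm₀).1
    obtain ⟨⟨-, -⟩, hmΩ⟩ := mem_cell_iff.1 hmcell
    have h1 : N₀ ^ Ω m₀ ≤ m₀ := pow_cardFactors_le_of_mem_roughIcc (Finset.mem_filter.1 hmcell).1
    rw [hmΩ] at h1
    have h2 : N₀ ≤ m₀ := le_trans (Nat.le_self_pow (by omega) N₀) h1
    have h3 : (N₀ : ℝ) ≤ m₀ := by exact_mod_cast h2
    linarith [hmd.2]
  have hYN : Y ≤ 2 * N := by
    have hpd := (mem_dyadic hN0'.le).1 (boxB_subset_dyadic hX0.le hδ.le hδ1 k hp₀)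
    have hp := (Finset.mem_filter.1 (Finset.mem_filter.1 hp₀).1).2.2
    have h3 : (N₀ : ℝ) ≤ p₀ := by exact_mod_cast hp
    linarith [hpd.2]
  -- hypotheses of Theorem 0 (b)
  have hx4 : (2 : ℝ) ^ (2 * n) ≤ x := h4n.trans hxlo
  obtain ⟨hNlo, hNhi⟩ := scale_range hn hx4 hxX hXY hYM hYN hM0 hMN
  have hx1 : 4 ≤ x := le_trans (le_trans (by
    calc (4 : ℝ) = 2 ^ (2 * 1) := by norm_num
      _ ≤ 2 ^ (2 * n) := pow_le_pow_right₀ (by norm_num) (by omega)) h4n) hxlo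
  have hQ : X ^ (1 / 4 : ℝ) ≤ x ^ (1 / 2 : ℝ) / Real.log x ^ B₁ := level_le hB₁ hx1 hxlo hxX hlev
  -- (A₂) for the prime box
  set mk : ℕ := max (N₀ - 1) ⌊X / (1 + δ) ^ (k + 1)⌋₊ with hmk
  set mk' : ℕ := min ⌊X⌋₊ ⌊X / (1 + δ) ^ k⌋₊ with hmk'
  have hβeq : (fun p => if p ∈ boxB N₀ T X δ k then (1 : ℝ) else 0) = ⇑(primePiece mk mk') :=
    indicator_boxB_eq_primePiece hN₀1 hX0.le hδ.le k
  have hSW : SiegelWalfiszHyp N 1 Csw (fun p => if p ∈ boxB N₀ T X δ k then (1 : ℝ) else 0) := by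
    rw [hβeq]
    refine hCsw X hX1 N ?_ ?_ mk mk' ?_ ?_
    · -- `X^{1/(2n)} ≤ Y/2 ≤ N`
      have h2 : 2 ≤ X ^ (1 / (2 * (n : ℝ))) := by
        have h := Real.rpow_le_rpow (by positivity) h4nX (by positivity : (0 : ℝ) ≤ 1 / (2 * (n : ℝ)))
        rwa [rpow_two_pow_two_mul n hn] at h
      have hsq : X ^ (1 / (2 * (n : ℝ))) * X ^ (1 / (2 * (n : ℝ))) = X ^ (1 / (n : ℝ)) := by
        rw [← Real.rpow_add hX0]; congr 1; field_simp; ring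
      nlinarith
    · exact div_le_self hX0.le (one_le_pow₀ (by linarith))
    · have : (⌊X / (1 + δ) ^ (k + 1)⌋₊ : ℝ) ≤ mk := by exact_mod_cast le_max_right _ _
      have h2 := Nat.lt_floor_add_one (X / (1 + δ) ^ (k + 1))
      rw [hN]; linarith
    · have h1 : (mk' : ℝ) ≤ ⌊X / (1 + δ) ^ k⌋₊ := by exact_mod_cast min_le_right _ _
      have h2 : (⌊X / (1 + δ) ^ k⌋₊ : ℝ) ≤ X / (1 + δ) ^ k := Nat.floor_le (by positivity)
      have h3 : X / (1 + δ) ^ k = (1 + δ) * N := by rw [hN, pow_succ]; field_simp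
      have h4 : (1 + δ) * N ≤ 2 * N := mul_le_mul_of_nonneg_right (by linarith) hN0'.le
      linarith
  -- residues
  set a : ℕ → ℤ := fun q => if q = 0 then 1 else (c q : ℤ) with ha
  have hacop : ∀ q : ℕ, IsCoprime (q : ℤ) (a q) := by
    intro q
    show IsCoprime (q : ℤ) (if q = 0 then (1 : ℤ) else (c q : ℤ))
    rcases Nat.eq_zero_or_pos q with h0 | hq
    · subst h0; rw [if_pos rfl]; exact isCoprime_one_right
    · rw [if_neg hq.ne']
      exact Nat.isCoprime_iff_coprime.2 (hc q hq).symm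
  -- Theorem 0 (b)
  have hmain := hBFI x (hx₀.trans hxlo) M N hMN hNlo hNhi _ hSW
    (fun m => if m ∈ boxA N₀ T j δ k i then (1 : ℝ) else 0) (X ^ (1 / 4 : ℝ)) hQ a hacop
  -- identify the summands
  have hsum : ∀ q ∈ Finset.Icc 1 ⌊X ^ ((1 : ℝ) / 4)⌋₊,
      |(#(((boxA N₀ T j δ k i) ×ˢ (boxB N₀ T X δ k)).filter (fun x : ℕ × ℕ => x.1 * x.2 ≡ c q [MOD q])) : ℝ) -
          (#(((boxA N₀ T j δ k i) ×ˢ (boxB N₀ T X δ k)).filter (fun x : ℕ × ℕ => (x.1 * x.2).Coprime q)) : ℝ) /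
            (Nat.totient q : ℝ)| =
        |bilinDisc (a q) M N (fun m => if m ∈ boxA N₀ T j δ k i then (1 : ℝ) else 0)
          (fun p => if p ∈ boxB N₀ T X δ k then (1 : ℝ) else 0) q| := by
    intro q hq
    have hq0 : q ≠ 0 := by have := (Finset.mem_Icc.1 hq).1; omega
    rw [pairDisc_box_eq_bilinDisc hX0.le hδ.le hδ1]
    simp only [ha, hq0, if_false, ← hM, ← hN]
  rw [Finset.sum_congr rfl hsum]
  refine hmain.trans ?_
  -- the right-hand side
  have hM2 : 1 / 2 ≤ M := by linarith
  have hN2 : 1 / 2 ≤ N := by linarith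
  have hnorm : Real.sqrt (l2Sq M fun m => if m ∈ boxA N₀ T j δ k i then (1 : ℝ) else 0) *
      Real.sqrt (l2Sq N fun p => if p ∈ boxB N₀ T X δ k then (1 : ℝ) else 0) * x ^ (1 / 2 : ℝ) ≤ 4 * x := by
    refine le_trans ?_ (sqrt_mul_sqrt_mul_rpow_le hM2 hN2 hMN)
    refine mul_le_mul_of_nonneg_right (mul_le_mul (Real.sqrt_le_sqrt (l2Sq_indicator_le hM0.le _))
      (Real.sqrt_le_sqrt (l2Sq_indicator_le hN0'.le _)) (Real.sqrt_nonneg _) (Real.sqrt_nonneg _)) ?_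
    positivity
  have hlogx : Real.log X / 2 ≤ Real.log x := by
    have h1 : Real.log (X ^ (3 / 4 : ℝ) / 2) ≤ Real.log x := Real.log_le_log (by positivity) hxlo
    have h2 : Real.log (X ^ (3 / 4 : ℝ) / 2) = 3 / 4 * Real.log X - Real.log 2 := by
      rw [Real.log_div (by positivity) (by norm_num), Real.log_rpow hX0]
    have h3 : Real.log 16 ≤ Real.log X := Real.log_le_log (by norm_num) h16
    have h4 : Real.log 16 = 4 * Real.log 2 := by
      rw [show (16 : ℝ) = 2 ^ 4 by norm_num, Real.log_pow]; norm_num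
    linarith
  have hlog2 : 0 < Real.log X / 2 := by positivity
  have hpowle : (Real.log X / 2) ^ A' ≤ Real.log x ^ A' := Real.rpow_le_rpow hlog2.le hlogx hA'.le
  have hpow0 : 0 < (Real.log X / 2) ^ A' := Real.rpow_pos_of_pos hlog2 _
  calc C₀ * Real.sqrt (l2Sq M fun m => if m ∈ boxA N₀ T j δ k i then (1 : ℝ) else 0) *
        Real.sqrt (l2Sq N fun p => if p ∈ boxB N₀ T X δ k then (1 : ℝ) else 0) * x ^ (1 / 2 : ℝ) /
        Real.log x ^ A'
      = C₀ * (Real.sqrt (l2Sq M fun m => if m ∈ boxA N₀ T j δ k i then (1 : ℝ) else 0) *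
        Real.sqrt (l2Sq N fun p => if p ∈ boxB N₀ T X δ k then (1 : ℝ) else 0) * x ^ (1 / 2 : ℝ)) /
        Real.log x ^ A' := by ring
    _ ≤ C₀ * (4 * x) / (Real.log X / 2) ^ A' := by
        refine div_le_div₀ (by positivity) (mul_le_mul_of_nonneg_left hnorm hC₀) hpow0 hpowle
    _ ≤ C₀ * (4 * X) / (Real.log X / 2) ^ A' := by gcongr
    _ = 4 * C₀ * X / (Real.log X / 2) ^ A' := by ring

end RoughCellsAP

end Literature.NumberTheory.Sieve
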